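import Mathlib
import Literature.Computability.AlgebraicComplexity.DeterminantalComplexity
import Summits.ValiantsHypothesis.ValiantsHypothesis.Theorems.BarrierLeverDefinableEquationsFullRankMethodWallTwo

/-!
# Route BarrierLever — support item `DefinableDcEquations` (stmt-8746): the FULL-RANK METHOD WALL
# holds on the determinantal slice `dc ≤ N/2` — the witness IS a determinant of size `n`
# (val-np-p5 g14)

The full-rank witness of `…FullRankMethodWallTwo.lean`, the product of `n` generic linear forms
`g_a = ∏_{k<n} ℓ_k` in `2n` variables, is the determinant of the DIAGONAL `n × n` matrix
`diag(ℓ_1, …, ℓ_n)` of linear forms: `dc(g_a) ≤ n` (`hasDetRepr_linProd`,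
`determinantalComplexity_linProd_le`).  Hence Raz's full-rank (min-partition-rank) method is
saturated on every determinantal slice `{f ∈ ℂ[x_1..x_{2n}] : deg f ≤ 2n, dc(f) ≤ m}` with
`m ≥ n` — for ALL `n ≥ 1`, no growth clause, no "eventually" (g10's transfer
`DcSliceWalls.exists_isFullRank_dcSlice` needed the super-quasi-polynomial threshold of item 8746
to swallow `SmallCircuits ℂ (2n) 3`):

* `exists_isFullRank_dcSlice_half` — a full-rank polynomial of degree `n` with `dc ≤ m`, every
  `m ≥ n`;
* `no_fullRankCertificate_dcSlice_half`, `not_isNaturalProof_of_zeroSet_notFullRank_dcSlice` —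
  no full-rank certificate (any size, any level, Boolean sums included) vanishes on the slice;
* `exists_isFullRank_vbpSlice` — in particular on the classes `{deg f ≤ 2n, dc(f) ≤ (2n)^b}` of
  the support item `SuccinctHittingSetsForVBP` (stmt-18966) for every `b ≥ 1`, and on the classes
  of item 8746 for every admissible threshold `m` with `m(2n) ≥ n`.

Reading for the dc axis (val-np-p5 g0–g2: poly(N)-size natural proofs EXIST against
`dc ≤ N + Θ(N/log N)`, `N` = number of variables): those certificates are singular-locus /
Macaulay equations, not rank methods; the min-partition-rank method itself dies already at
`dc ≤ N/2`.  What this is NOT: nothing on the truth of item 8746 (OPEN), on the crux 8745/8749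
(`b = 2` OPEN) or on `VP ≠ VNP`.  No definitions, no named facts, standard axioms.
Refs: Mignon–Ressayre 2004 §1 (dc); Raz–Yehudayoff 2008 §4.2.2; Forbes–Shpilka–Volk 2018 Def. 1.
-/

-- `Summit.ValiantsHypothesis.ValiantsHypothesis.…` repeats a component by the D-0017 layout
-- (single-conjunct summit), which the `dupNamespace` linter flags; the name is mandated.
set_option linter.dupNamespace false

noncomputable section

namespace Summit.ValiantsHypothesis.ValiantsHypothesis.Theorems.BarrierLeverDefinableEquations

open MvPolynomial
open Literature.Computability.AlgebraicComplexity hiding IsSyntacticallyMultilinear smCircuitSize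
open Literature.Barriers.ValiantsHypothesis
open scoped BigOperators

namespace FullRankMethodWallTwo

/-! ## §1 `∏_k ℓ_k = det diag(ℓ_1, …, ℓ_n)` -/

section DetRepr

variable (n : ℕ)

/-- A linear form has total degree `≤ 1`. [folklore] -/
theorem totalDegree_linForm_le {R : Type*} [CommSemiring R] {N : ℕ} (a : Fin N → R) :
    (∑ i : Fin N, C (a i) * X i : MvPolynomial (Fin N) R).totalDegree ≤ 1 := by
  refine (totalDegree_finsetSum _ _).trans (Finset.sup_le fun i _ => ?_)
  refine (totalDegree_mul _ _).trans ?_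
  rw [totalDegree_C, zero_add]
  rcases subsingleton_or_nontrivial R with hR | hR
  · simp [Subsingleton.elim (X i : MvPolynomial (Fin N) R) 0]
  · rw [totalDegree_X]

/-- **The product of `n` linear forms is the determinant of the diagonal `n × n` matrix of those
forms** — an affine determinantal representation of size `n`. [cite: MignonRessayre2004, §1] -/
theorem hasDetRepr_linProd (a : Fin n → Fin (2 * n) → ℂ) : HasDetRepr (linProd n a) n := by
  refine ⟨Matrix.diagonal fun k => ∑ i : Fin (2 * n), C (a k i) * X i, fun i j => ?_, ?_⟩
  · by_cases h : i = j
    · subst h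
      rw [Matrix.diagonal_apply_eq]
      exact totalDegree_linForm_le (a i)
    · rw [Matrix.diagonal_apply_ne _ h, totalDegree_zero]
      exact Nat.zero_le _
  · rw [Matrix.det_diagonal]
    rfl

/-- Hence `dc(∏_k ℓ_k) ≤ n`. [cite: MignonRessayre2004, §1] -/
theorem determinantalComplexity_linProd_le (a : Fin n → Fin (2 * n) → ℂ) :
    determinantalComplexity (linProd n a) ≤ n :=
  determinantalComplexity_le_of_hasDetRepr (hasDetRepr_linProd n a)

end DetRepr

/-! ## §2 The wall on determinantal slices `dc ≤ m`, `m ≥ n` -/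

section Wall

/-- **A full-rank polynomial of determinantal complexity `≤ n`** in `2n` variables, degree `n`:
so every slice `{deg ≤ 2n, dc ≤ m}` with `m ≥ n` contains one. [cite: RazYehudayoff2008, §4.2.2]
[cite: MignonRessayre2004, §1] -/
theorem exists_isFullRank_dcSlice_half {n m : ℕ} (hm : n ≤ m) :
    ∃ g : MvPolynomial (Fin (2 * n)) ℂ, g.totalDegree ≤ 2 * n ∧
      determinantalComplexity g ≤ m ∧ IsFullRank n g := by
  obtain ⟨a, ha⟩ := exists_isFullRank_linProd n
  exact ⟨linProd n a, (totalDegree_linProd_le n a).trans (by omega),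
    (determinantalComplexity_linProd_le n a).trans hm, ha⟩

/-- **No full-rank certificate vanishes on a determinantal slice `dc ≤ m`, `m ≥ n`**: no `D` in
the coefficient variables (any size, any degree, Boolean sums included) nonzero at every
full-rank polynomial of degree `≤ 2n` vanishes on `{f : deg f ≤ 2n, dc(f) ≤ m}`.
[cite: ForbesShpilkaVolk2018, Def. 1] -/
theorem no_fullRankCertificate_dcSlice_half {n m : ℕ} (hm : n ≤ m) :
    ¬ ∃ D : MvPolynomial (degLEMonomials (2 * n)) ℂ,
      (∀ g : MvPolynomial (Fin (2 * n)) ℂ, g.totalDegree ≤ 2 * n → IsFullRank n g →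
        eval (coeffVector (degLEMonomials (2 * n)) g) D ≠ 0) ∧
      ∀ f : MvPolynomial (Fin (2 * n)) ℂ, f.totalDegree ≤ 2 * n →
        determinantalComplexity f ≤ m → eval (coeffVector (degLEMonomials (2 * n)) f) D = 0 := by
  rintro ⟨D, hsound, hvan⟩
  obtain ⟨g, hdeg, hdc, hfull⟩ := exists_isFullRank_dcSlice_half hm
  exact hsound g hdeg hfull (hvan g hdeg hdc)

/-- In FSV's vocabulary: a `D` whose zero set on degree-`≤ 2n` coefficient vectors is exactly the
non-full-rank locus is not an `IsNaturalProof` against the slice `{deg ≤ 2n, dc ≤ m}`, `m ≥ n`,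
in ANY distinguisher class. [cite: ForbesShpilkaVolk2018, Def. 1] -/
theorem not_isNaturalProof_of_zeroSet_notFullRank_dcSlice {n m : ℕ} (hm : n ≤ m)
    (𝒟 : Set (MvPolynomial (degLEMonomials (2 * n)) ℂ)) (D : MvPolynomial (degLEMonomials (2 * n)) ℂ)
    (hD : ∀ g : MvPolynomial (Fin (2 * n)) ℂ, g.totalDegree ≤ 2 * n →
      (eval (coeffVector (degLEMonomials (2 * n)) g) D = 0 ↔ ¬ IsFullRank n g)) :
    ¬ IsNaturalProof (degLEMonomials (2 * n))
      {f : MvPolynomial (Fin (2 * n)) ℂ | f.totalDegree ≤ 2 * n ∧ determinantalComplexity f ≤ m}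
      𝒟 D := by
  rintro ⟨-, -, hvan⟩
  obtain ⟨g, hdeg, hdc, hfull⟩ := exists_isFullRank_dcSlice_half hm
  exact (hD g hdeg).1 (hvan g ⟨hdeg, hdc⟩) hfull

/-- **On the VBP slices of item 18966 / the classes of item 8746**: for every `b ≥ 1` and `n ≥ 1`
the class `{f ∈ ℂ[x_1..x_{2n}] : deg f ≤ 2n, dc(f) ≤ (2n)^b}` contains a full-rank polynomial
(`n ≤ 2n ≤ (2n)^b`). [cite: ForbesShpilkaVolk2018, Def. 3] -/
theorem exists_isFullRank_vbpSlice {n b : ℕ} (hn : 1 ≤ n) (hb : 1 ≤ b) :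
    ∃ g ∈ {f : MvPolynomial (Fin (2 * n)) ℂ | f.totalDegree ≤ 2 * n ∧
      determinantalComplexity f ≤ (2 * n) ^ b}, IsFullRank n g := by
  have hm : n ≤ (2 * n) ^ b :=
    calc n ≤ 2 * n := by omega
      _ = (2 * n) ^ 1 := (pow_one _).symm
      _ ≤ (2 * n) ^ b := Nat.pow_le_pow_right (by omega) hb
  obtain ⟨g, hdeg, hdc, hfull⟩ := exists_isFullRank_dcSlice_half hm
  exact ⟨g, ⟨hdeg, hdc⟩, hfull⟩

/-- The same for any threshold FUNCTION `m` at an argument where `m(2n) ≥ n` — in particular for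
the admissible thresholds of item 8746 as soon as `m(2n) ≥ n` (their growth clause gives this
eventually; here no clause is needed). [cite: ForbesShpilkaVolk2018, Def. 3] -/
theorem exists_isFullRank_dcSlice_threshold (m : ℕ → ℕ) {n : ℕ} (hm : n ≤ m (2 * n)) :
    ∃ g ∈ {f : MvPolynomial (Fin (2 * n)) ℂ | f.totalDegree ≤ 2 * n ∧
      determinantalComplexity f ≤ m (2 * n)}, IsFullRank n g := by
  obtain ⟨g, hdeg, hdc, hfull⟩ := exists_isFullRank_dcSlice_half hm
  exact ⟨g, ⟨hdeg, hdc⟩, hfull⟩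

end Wall

end FullRankMethodWallTwo

end Summit.ValiantsHypothesis.ValiantsHypothesis.Theorems.BarrierLeverDefinableEquations
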